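import Mathlib
import HarnessLib
import Summits.CriticalPhenomena.PercolationContinuityZ3.Theses.PercTreeValue
import Summits.CriticalPhenomena.PercolationContinuityZ3.Theorems.PercTreeValueTetrahedronHarrisGapStubCondHarris
import Summits.CriticalPhenomena.PercolationContinuityZ3.Theorems.PercTreeValueTetrahedronHarrisGapStubG
import Summits.CriticalPhenomena.PercolationContinuityZ3.Theorems.PercTreeValueTetrahedronHarrisGapVarianceReduction
import Literature.Probability.Percolation.BlockResampling
import Literature.Probability.Percolation.InfiniteClusterDensity
import Literature.Probability.Percolation.TwoPointFunction
import Literature.Probability.Percolation.PercolationProofs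

/-!
# Crux `TetrahedronHarrisGap` (stmt-CriticalPhenomena-7799), line `SketchIdeator1` rev 5:
# the variance-free composition — bulk covariance ⟹ crux, and blocking ∧ coherence ⟹ bulk covariance

Line `SketchIdeator1` (card `corner-ball-total-covariance`; skeleton `Cruxes/TetrahedronHarrisGap/Lines/SketchIdeator1.lean`, rev 5,
lead prover-line-stmt-CriticalPhenomena-7799-c1-0).  With `f_r = P(0 ↔ a_r | ω off K_r)`, `g_r = P(b_r ↔ c_r | ω off K_r)`
(`blockCondProb`; `K_r` = the lattice edges touching the four corner boxes of sup-radius `r/8`):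

* `crux_of_bulkCovariance` : `(∃ c' > 0, ∀ r ≥ r₀, c' τ(0,a_r) τ(b_r,c_r) ≤ Cov(f_r, g_r)) → TetrahedronHarrisGap` (`δ = c'`) — the
  shortest composition of the line: `P(A ∩ B) ≥ ∫ f g` (conditional Harris in the corner block) and nothing else.  The hypothesis
  ("bulk covariance") merges the influence-variance and coherence inputs of `…CoherenceReduction.lean` / `…VarianceReduction.lean`
  into one statement that does not mention `Var f_r` (whose size depends on the corner-box radius: MC `Var f/ττ ≈ 3.7, 1.8, 0.8` at
  `m = r/16, r/8, r/4`, r = 32, while `Cov(f,g)/ττ ≈ 0.25–0.27` is stable in m and in r = 16…32);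
* `bulkCovariance_of_block_of_coherence` : blocking ∧ coherence ⟹ bulk covariance with `c' = c · c_B` — so the registered pair
  (stmt-0846, `stub_coherence`) sits above this single statement in the hierarchy, and the crux sits below it.

No new definitions; sorry-free; all ℤ³-inputs are HYPOTHESES (reductions, not a proof of the crux).
-/

noncomputable section

open MeasureTheory Filter Set
open Literature.Probability.Percolation Literature.Probability.LatticeModels

namespace Summit.CriticalPhenomena.PercolationContinuityZ3.Theorems.TetrahedronHarrisGap

/-- **crux_of_bulkCovariance** (registered sub-goal of stmt-CriticalPhenomena-7799). A uniform lower bound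
`c' τ(0,a_r) τ(b_r,c_r) ≤ Cov(f_r, g_r)` on the covariance of the two bulk hook probabilities implies the crux with `δ = c'`:
`P(A ∩ B) ≥ ∫ f g` (conditional Harris inside the corner block, `stub_condHarris`) `= Cov(f,g) + τ_A τ_B ≥ (1 + c') τ_A τ_B`
(`∫ f = τ_A`, `∫ g = τ_B`, tower property). -/
theorem crux_of_bulkCovariance :
    (∃ c' : ℝ, 0 < c' ∧ ∃ r₀ : ℕ, ∀ r : ℕ, r₀ ≤ r →
      let K : Finset (Sym2 (Site 3)) :=
        armEdges (r / 8) (0 : Site 3) ∪ armEdges (r / 8) ![(r : ℤ), (r : ℤ), 0] ∪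
          armEdges (r / 8) ![(r : ℤ), 0, (r : ℤ)] ∪ armEdges (r / 8) ![0, (r : ℤ), (r : ℤ)];
      let f : BondConfig (Site 3) → ℝ :=
        blockCondProb (zdGraph 3) (criticalProbI 3) K (openConn (0 : Site 3) ![(r : ℤ), (r : ℤ), 0]);
      let g : BondConfig (Site 3) → ℝ :=
        blockCondProb (zdGraph 3) (criticalProbI 3) K (openConn ![(r : ℤ), 0, (r : ℤ)] ![0, (r : ℤ), (r : ℤ)]);
      c' * (tau 3 (criticalProbI 3) 0 ![(r : ℤ), (r : ℤ), 0] *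
          tau 3 (criticalProbI 3) ![(r : ℤ), 0, (r : ℤ)] ![0, (r : ℤ), (r : ℤ)]) ≤
        ∫ ω, f ω * g ω ∂(bondPercolation (zdGraph 3) (criticalProbI 3)) -
          (∫ ω, f ω ∂(bondPercolation (zdGraph 3) (criticalProbI 3))) *
            (∫ ω, g ω ∂(bondPercolation (zdGraph 3) (criticalProbI 3)))) →
    Summit.CriticalPhenomena.PercolationContinuityZ3.Theses.PercTreeValue.TetrahedronHarrisGap := by
  intro hCov
  classical
  obtain ⟨c', hc', r₁, hCov⟩ := hCov
  unfold Summit.CriticalPhenomena.PercolationContinuityZ3.Theses.PercTreeValue.TetrahedronHarrisGap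
  refine ⟨c', hc', r₁, fun r hr => ?_⟩
  have hCov' := hCov r hr
  dsimp only at hCov'
  clear hCov
  set P : Measure (BondConfig (Site 3)) := bondPercolation (zdGraph 3) (criticalProbI 3) with hP
  set K : Finset (Sym2 (Site 3)) :=
    armEdges (r / 8) (0 : Site 3) ∪ armEdges (r / 8) ![(r : ℤ), (r : ℤ), 0] ∪
      armEdges (r / 8) ![(r : ℤ), 0, (r : ℤ)] ∪ armEdges (r / 8) ![0, (r : ℤ), (r : ℤ)] with hK
  set A : Set (BondConfig (Site 3)) := openConn (0 : Site 3) ![(r : ℤ), (r : ℤ), 0] with hA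
  set B : Set (BondConfig (Site 3)) := openConn ![(r : ℤ), 0, (r : ℤ)] ![0, (r : ℤ), (r : ℤ)] with hB
  set f : BondConfig (Site 3) → ℝ := blockCondProb (zdGraph 3) (criticalProbI 3) K A with hf
  set g : BondConfig (Site 3) → ℝ := blockCondProb (zdGraph 3) (criticalProbI 3) K B with hg
  have hAm : MeasurableSet A := measurableSet_openConn_holds _ _
  have hBm : MeasurableSet B := measurableSet_openConn_holds _ _
  have hAu : IsUpperSet A := isUpperSet_openConn _ _
  have hBu : IsUpperSet B := isUpperSet_openConn _ _
  have hτA : tau 3 (criticalProbI 3) 0 ![(r : ℤ), (r : ℤ), 0] = ∫ ω, f ω ∂P := by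
    rw [tau_def, hf, integral_blockCondProb_eq _ _ K hAm]
  have hτB : tau 3 (criticalProbI 3) ![(r : ℤ), 0, (r : ℤ)] ![0, (r : ℤ), (r : ℤ)] = ∫ ω, g ω ∂P := by
    rw [tau_def, hg, integral_blockCondProb_eq _ _ K hBm]
  -- conditional Harris: `∫ f g ≤ P(A ∩ B)`
  have hcond := stub_condHarris (criticalProbI 3) K A B hAu hBu hAm hBm
  rw [← hτA, ← hτB] at hCov'
  show (1 + c') * tau 3 (criticalProbI 3) 0 ![(r : ℤ), (r : ℤ), 0] *
      tau 3 (criticalProbI 3) ![(r : ℤ), 0, (r : ℤ)] ![0, (r : ℤ), (r : ℤ)] ≤ P.real (A ∩ B)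
  nlinarith [hcond, hCov']

/-- **bulkCovariance_of_block_of_coherence** (registered sub-goal of stmt-CriticalPhenomena-7799). Blocking `P(f_r = 0) ≥ c_B` and
coherence `c · Var f_r ≤ Cov(f_r, g_r)` imply the bulk-covariance bound with `c' = c · c_B`:
`Cov(f,g) ≥ c Var f ≥ c c_B τ_A² = c c_B τ_A τ_B` (`varLower_of_block`, `tau_opposite_edge_eq`). -/
theorem bulkCovariance_of_block_of_coherence :
    (∃ c_B : ℝ, 0 < c_B ∧ ∃ r₀ : ℕ, ∀ r : ℕ, r₀ ≤ r →
      let K : Finset (Sym2 (Site 3)) :=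
        armEdges (r / 8) (0 : Site 3) ∪ armEdges (r / 8) ![(r : ℤ), (r : ℤ), 0] ∪
          armEdges (r / 8) ![(r : ℤ), 0, (r : ℤ)] ∪ armEdges (r / 8) ![0, (r : ℤ), (r : ℤ)];
      let f : BondConfig (Site 3) → ℝ :=
        blockCondProb (zdGraph 3) (criticalProbI 3) K (openConn (0 : Site 3) ![(r : ℤ), (r : ℤ), 0]);
      let g : BondConfig (Site 3) → ℝ :=
        blockCondProb (zdGraph 3) (criticalProbI 3) K (openConn ![(r : ℤ), 0, (r : ℤ)] ![0, (r : ℤ), (r : ℤ)]);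
      c_B ≤ (bondPercolation (zdGraph 3) (criticalProbI 3)).real {ω | f ω = 0} ∧
        c_B ≤ (bondPercolation (zdGraph 3) (criticalProbI 3)).real {ω | g ω = 0}) →
    (∃ c : ℝ, 0 < c ∧ ∃ r₀ : ℕ, ∀ r : ℕ, r₀ ≤ r →
      let K : Finset (Sym2 (Site 3)) :=
        armEdges (r / 8) (0 : Site 3) ∪ armEdges (r / 8) ![(r : ℤ), (r : ℤ), 0] ∪
          armEdges (r / 8) ![(r : ℤ), 0, (r : ℤ)] ∪ armEdges (r / 8) ![0, (r : ℤ), (r : ℤ)];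
      let f : BondConfig (Site 3) → ℝ :=
        blockCondProb (zdGraph 3) (criticalProbI 3) K (openConn (0 : Site 3) ![(r : ℤ), (r : ℤ), 0]);
      let g : BondConfig (Site 3) → ℝ :=
        blockCondProb (zdGraph 3) (criticalProbI 3) K (openConn ![(r : ℤ), 0, (r : ℤ)] ![0, (r : ℤ), (r : ℤ)]);
      c * (∫ ω, f ω ^ 2 ∂(bondPercolation (zdGraph 3) (criticalProbI 3)) -
            (∫ ω, f ω ∂(bondPercolation (zdGraph 3) (criticalProbI 3))) ^ 2) ≤
        ∫ ω, f ω * g ω ∂(bondPercolation (zdGraph 3) (criticalProbI 3)) -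
          (∫ ω, f ω ∂(bondPercolation (zdGraph 3) (criticalProbI 3))) *
            (∫ ω, g ω ∂(bondPercolation (zdGraph 3) (criticalProbI 3)))) →
    (∃ c' : ℝ, 0 < c' ∧ ∃ r₀ : ℕ, ∀ r : ℕ, r₀ ≤ r →
      let K : Finset (Sym2 (Site 3)) :=
        armEdges (r / 8) (0 : Site 3) ∪ armEdges (r / 8) ![(r : ℤ), (r : ℤ), 0] ∪
          armEdges (r / 8) ![(r : ℤ), 0, (r : ℤ)] ∪ armEdges (r / 8) ![0, (r : ℤ), (r : ℤ)];
      let f : BondConfig (Site 3) → ℝ :=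
        blockCondProb (zdGraph 3) (criticalProbI 3) K (openConn (0 : Site 3) ![(r : ℤ), (r : ℤ), 0]);
      let g : BondConfig (Site 3) → ℝ :=
        blockCondProb (zdGraph 3) (criticalProbI 3) K (openConn ![(r : ℤ), 0, (r : ℤ)] ![0, (r : ℤ), (r : ℤ)]);
      c' * (tau 3 (criticalProbI 3) 0 ![(r : ℤ), (r : ℤ), 0] *
          tau 3 (criticalProbI 3) ![(r : ℤ), 0, (r : ℤ)] ![0, (r : ℤ), (r : ℤ)]) ≤
        ∫ ω, f ω * g ω ∂(bondPercolation (zdGraph 3) (criticalProbI 3)) -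
          (∫ ω, f ω ∂(bondPercolation (zdGraph 3) (criticalProbI 3))) *
            (∫ ω, g ω ∂(bondPercolation (zdGraph 3) (criticalProbI 3)))) := by
  intro hBl hCoh
  classical
  obtain ⟨cV, hcV, r₁, hV⟩ := varLower_of_block hBl
  obtain ⟨c, hc, r₂, hCoh⟩ := hCoh
  refine ⟨c * cV, by positivity, max r₁ r₂, fun r hr => ?_⟩
  have hr₁ : r₁ ≤ r := le_trans (le_max_left _ _) hr
  have hr₂ : r₂ ≤ r := le_trans (le_max_right _ _) hr
  have hV' := hV r hr₁
  have hCoh' := hCoh r hr₂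
  dsimp only at hV' hCoh' ⊢
  clear hV hCoh
  rw [tau_opposite_edge_eq _ r]
  set τ : ℝ := tau 3 (criticalProbI 3) 0 ![(r : ℤ), (r : ℤ), 0] with hτ
  set P : Measure (BondConfig (Site 3)) := bondPercolation (zdGraph 3) (criticalProbI 3) with hP
  set K : Finset (Sym2 (Site 3)) :=
    armEdges (r / 8) (0 : Site 3) ∪ armEdges (r / 8) ![(r : ℤ), (r : ℤ), 0] ∪
      armEdges (r / 8) ![(r : ℤ), 0, (r : ℤ)] ∪ armEdges (r / 8) ![0, (r : ℤ), (r : ℤ)] with hK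
  set f : BondConfig (Site 3) → ℝ :=
    blockCondProb (zdGraph 3) (criticalProbI 3) K (openConn (0 : Site 3) ![(r : ℤ), (r : ℤ), 0]) with hf
  set g : BondConfig (Site 3) → ℝ :=
    blockCondProb (zdGraph 3) (criticalProbI 3) K (openConn ![(r : ℤ), 0, (r : ℤ)] ![0, (r : ℤ), (r : ℤ)]) with hg
  have h1 : c * (cV * τ ^ 2) ≤ c * (∫ ω, f ω ^ 2 ∂P - (∫ ω, f ω ∂P) ^ 2) :=
    mul_le_mul_of_nonneg_left hV' hc.le
  nlinarith [hCoh', h1]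

end Summit.CriticalPhenomena.PercolationContinuityZ3.Theorems.TetrahedronHarrisGap

end
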